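import Literature.NumberTheory.EllipticCurves.GreenbergVatsal2000.ResidualSelmerGroups
import Literature.NumberTheory.EllipticCurves.GreenbergVatsal2000.GreenbergSelmerGroups
import Literature.NumberTheory.EllipticCurves.Kobayashi2003.SignedSelmer
import Literature.NumberTheory.EllipticCurves.IwasawaSelmerProofs
import Literature.NumberTheory.EllipticCurves.KodairaNeronUnramifiedInertiaProofs
import Literature.NumberTheory.EllipticCurves.SelmerFiniteProofs
import Literature.NumberTheory.EllipticCurves.GeomPointsGaloisModule
import Summits.BirchSwinnertonDyer.BirchSwinnertonDyer.Theorems.ThetaPartnerAtTwoSignedTransportAtTwoResidualKummer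
import Summits.BirchSwinnertonDyer.BirchSwinnertonDyer.Theorems.ThetaPartnerAtTwoSignedTransportAtTwoResidualUpper
import Summits.BirchSwinnertonDyer.BirchSwinnertonDyer.Theorems.ThetaPartnerAtTwoSignedTransportAtTwoResidualNaturality
import HarnessLib

/-!
# `Sel^ε(E/K_∞) ≤ Sel♯_{S₀}(E/K_∞)`: the signed Selmer group lies in the IMPRIMITIVE signed Selmer group, and inertia at good
# places `v ∤ p` acts trivially on `E[p^∞]` — local facts away from `p` for link 1 of the one-curve residual `λ`-formula
# `stub_rlf2` of line `bridge` (crux `SignedTransportAtTwo`, stmt-BirchSwinnertonDyer-20333, route `ThetaPartnerAtTwo`)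
# (lead prover bsd-wall-tp2-p1 g6; `--supports`; route-independent, closes nothing)

HONEST FRAMING. THEOREMS ONLY, no definition: the imprimitive signed Selmer group is SPELLED OUT as the subgroup
`unramifiedOutside κ.kerSubgroup E[p^∞] p S₀ ⊓ ⨅_{v ∣ p, σ} conj_σ⁻¹(signed Kummer condition w.r.t. ⨆ₙ E^ε(K_{n,v}))` of
`H¹(K_∞, E[p^∞])` (GV 2000 p. 20 "`S^{Σ₀}_A(ℚ_∞)`" with Kobayashi's condition at `p`; no archimedean condition). BSD is not
proved by any of this; nothing is asserted about any characteristic ideal. Any number field `K`, any prime `p`, any `H ≤ Γ_K`: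

* `mem_unramifiedKer_of_mem_localKerOver` — a class of `H¹(H, E[p^∞])` satisfying the classical local condition at a good
  place `v ∤ p` is unramified at `v` (Silverman X.4.2 via the tree's `smul_localPoints_eq_of_mem_inertia_holds`; the
  `p^∞`-level companion of p549157's residual `mem_unramifiedKer_of_pushH1_mem_localKerOver`);
* `smul_eq_of_inertiaIn` — `H ⊓ I_v` acts trivially on `E[p^∞]` at good `v ∤ p`;
* `mem_unramifiedKer_of_pushH1_mem_unramifiedKer` — hence a residual class is unramified at `v` as soon as its Kummer
  image is;
* `signedSelmerInfty_le_imprimitive` — `Sel^ε(E/K_∞) ≤ Sel♯_{S₀}` when `S₀` contains the bad places (GV p. 20 "Obviously,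
  `S_A(ℚ_∞) ⊆ S^{Σ₀}_A(ℚ_∞)`", for Kobayashi's condition at `p`).

References: [GreenbergVatsal2000] §2 pp. 17, 20, 28; [SilvermanAEC2009] X.§4 Thm. 4.2; [Kobayashi2003] Def. 1.1.
-/

set_option autoImplicit false
-- D-0017: single-problem summit, so `Summit.BirchSwinnertonDyer.BirchSwinnertonDyer.…` repeats a namespace BY DESIGN.
set_option linter.dupNamespace false

noncomputable section

open scoped Classical AddSubgroup

open WeierstrassCurve NumberField IsDedekindDomain Literature Literature.NumberTheory.EllipticCurves
  Literature.NumberTheory.GaloisRepresentations Literature.NumberTheory.EllipticCurves.Rank1Residual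
  Literature.NumberTheory.EllipticCurves.Kobayashi2003 Literature.NumberTheory.EllipticCurves.GreenbergVatsal2000
  ZpExtension

namespace Summit.BirchSwinnertonDyer.BirchSwinnertonDyer.Theorems.SignedTransportAtTwo

universe u

/-! ## §1. Local facts away from `p` (any number field) -/

section Curve

variable {K : Type u} [Field K] [NumberField K] (W : WeierstrassCurve K) [W.IsElliptic] (p : ℕ)
  (H : Subgroup (Field.absoluteGaloisGroup K))

omit [NumberField K] in
/-- `(p^k) ∉ v` for a finite place `v ∤ p`. [folklore] -/
theorem natCast_pow_notMem {v : HeightOneSpectrum (𝓞 K)} (hpv : ((p : ℕ) : 𝓞 K) ∉ v.asIdeal) (k : ℕ) :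
    (((p ^ k : ℕ) : ℤ) : 𝓞 K) ∉ v.asIdeal := by
  rw [Int.cast_natCast, Nat.cast_pow]
  exact fun h ↦ hpv (v.isPrime.mem_of_pow_mem k h)

/-- **Selmer classes are unramified at good `v ∤ p` (the `p^∞`-level).** A class `c ∈ H¹(H, E[p^∞])` dying in
`H¹(Gal(K̄_v/L_w), E(K̄_v))` at a good place `v ∤ p` is unramified at `v`: a cocycle `φ` of `c` has `ι φ(res τ) = τQ − Q`
for some `Q ∈ E(K̄_v)`; each value is `p^k`-torsion, so for `τ` in the local inertia group `p^k(τQ − Q) = 0` forces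
`τQ = Q` (Silverman X.4.2, tree `smul_localPoints_eq_of_mem_inertia_holds`), i.e. `φ` vanishes on `H ⊓ I_v`. GV p. 17
("the last condition is equivalent to `[σ|_{I_η}] = 0`"). [cite: GreenbergVatsal2000, §2 p. 17] [cite: SilvermanAEC2009, X.§4 Thm. 4.2] -/
theorem mem_unramifiedKer_of_mem_localKerOver {v : HeightOneSpectrum (𝓞 K)}
    (hv : W.HasGoodReductionAt v) (hpv : ((p : ℕ) : 𝓞 K) ∉ v.asIdeal)
    (c : subgroupH1 H ↥(W.geomPrimaryTorsion p)) (hc : c ∈ W.localKerOver p H (v.adicCompletion K)) :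
    c ∈ GreenbergVatsal2000.unramifiedKer H ↥(W.geomPrimaryTorsion p) v := by
  set ι := closureEmb (K := K) (v.adicCompletion K) with hι
  obtain ⟨φ, rfl⟩ := oneCocycleClass_surjective _ c
  rw [localKerOver, AddMonoidHom.mem_ker, localResOver, localResOverOfEmb] at hc
  erw [map_oneCocycleClass] at hc
  obtain ⟨Q, hQ⟩ := (oneCocycleClass_eq_zero_iff _ _).mp hc
  -- the value of `φ` at `res τ`, pushed to `E(K̄_v)`, is `τ Q − Q`
  have hval : ∀ τ : localSubgroupOfEmb H ι,
      pointsMapOfEmb W ι ((φ.1 (resGalSubgroupOfEmb H ι τ) : ↥(W.geomPrimaryTorsion p)) : W.geomPoints) =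
        (τ : Field.absoluteGaloisGroup (v.adicCompletion K)) • Q - Q :=
    fun τ ↦ hQ τ
  -- on the local inertia group the values vanish
  obtain ⟨𝔐, h𝔐⟩ := v.localPrimesAbove_nonempty
  obtain ⟨w, hw⟩ := v.exists_spectralValuation
  have hvan : ∀ τ : localSubgroupOfEmb H ι,
      (τ : Field.absoluteGaloisGroup (v.adicCompletion K)) ∈ absInertia (v.adicCompletion K) →
        φ.1 (resGalSubgroupOfEmb H ι τ) = 0 := by
    intro τ hτ
    have hτ' : (τ : Field.absoluteGaloisGroup (v.adicCompletion K)) ∈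
        𝔐.inertia (Field.absoluteGaloisGroup (v.adicCompletion K)) := by
      rwa [HeightOneSpectrum.inertia_eq_absInertia hw h𝔐]
    obtain ⟨k, hk⟩ := (AddCommGroup.mem_primaryComponent (p := p)).mp (φ.1 (resGalSubgroupOfEmb H ι τ)).2
    have hp0 : ((p ^ k : ℕ) : ℤ) • ((τ : Field.absoluteGaloisGroup (v.adicCompletion K)) • Q - Q) = 0 := by
      rw [← hval τ, ← map_zsmul, natCast_zsmul, hk, map_zero]
    have hfix := W.smul_localPoints_eq_of_mem_inertia_holds v (fun h ↦ h hv) (n := ((p ^ k : ℕ) : ℤ))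
      (natCast_pow_notMem p hpv k) h𝔐 hτ' hp0
    have h0 : pointsMapOfEmb W ι ((φ.1 (resGalSubgroupOfEmb H ι τ) : ↥(W.geomPrimaryTorsion p)) : W.geomPoints) = 0 := by
      rw [hval τ, hfix, sub_self]
    have h1 := pointsMapOfEmb_injective W ι (h0.trans (map_zero _).symm)
    exact Subtype.ext h1
  -- conclude: `φ` vanishes on `H ⊓ I_v`
  change oneCocycleClass _ φ ∈ (resH1Hom (GreenbergSelmer.inertiaInToH H v) (AddMonoidHom.id _) _).ker
  rw [AddMonoidHom.mem_ker]
  erw [map_oneCocycleClass]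
  refine (oneCocycleClass_eq_zero_iff _ _).mpr ⟨0, fun x ↦ ?_⟩
  rw [contOneCocycles.pullback_apply, map_zero, sub_zero]
  obtain ⟨hxH, hxI⟩ := (GreenbergSelmer.mem_inertiaIn_iff H v x.1).mp x.2
  obtain ⟨τ, hτI, hτx⟩ := Subgroup.mem_map.mp hxI
  have hτH : τ ∈ localSubgroupOfEmb H ι := by
    rw [mem_localSubgroupOfEmb_iff]
    change (resGal (K := K) (v.adicCompletion K)) τ ∈ H
    rw [WeierstrassCurve.resGal_eq_absGaloisRestrict]
    change (absGaloisRestrict K (v.adicCompletion K)).toMonoidHom τ ∈ H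
    rw [hτx]; exact hxH
  have e : GreenbergSelmer.inertiaInToH H v x = resGalSubgroupOfEmb H ι ⟨τ, hτH⟩ := by
    apply Subtype.ext
    change ((x : GreenbergSelmer.decomp (K := K) v) : Field.absoluteGaloisGroup K) = resGalOfEmb ι τ
    rw [← hτx]; rfl
  change (resHomOfEquivariant _ _ _).hom (φ.1 (GreenbergSelmer.inertiaInToH H v x)) = 0
  rw [e, hvan ⟨τ, hτH⟩ hτI, map_zero]

/-- **`H ⊓ I_v` acts trivially on `E[p^∞]` at a good place `v ∤ p`** (Néron–Ogg–Shafarevich, easy direction: for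
`τ ∈ I_v` and `P ∈ E[p^k]`, `p^k(τP − P) = 0` forces `τP = P`, Silverman VII.4.1 / X.4.2 via the tree's
`smul_localPoints_eq_of_mem_inertia_holds`). [cite: SilvermanAEC2009, X.§4 Thm. 4.2] -/
theorem smul_eq_of_inertiaIn {v : HeightOneSpectrum (𝓞 K)} (hv : W.HasGoodReductionAt v)
    (hpv : ((p : ℕ) : 𝓞 K) ∉ v.asIdeal) (x : ↥(GreenbergSelmer.inertiaIn H v)) (m : ↥(W.geomPrimaryTorsion p)) :
    ((x : GreenbergSelmer.decomp (K := K) v) : Field.absoluteGaloisGroup K) • m = m := by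
  set ι := closureEmb (K := K) (v.adicCompletion K) with hι
  obtain ⟨-, hxI⟩ := (GreenbergSelmer.mem_inertiaIn_iff H v x.1).mp x.2
  obtain ⟨τ, hτI, hτx⟩ := Subgroup.mem_map.mp hxI
  obtain ⟨𝔐, h𝔐⟩ := v.localPrimesAbove_nonempty
  obtain ⟨w, hw⟩ := v.exists_spectralValuation
  have hτ' : τ ∈ 𝔐.inertia (Field.absoluteGaloisGroup (v.adicCompletion K)) := by
    rwa [HeightOneSpectrum.inertia_eq_absInertia hw h𝔐]
  -- `x = res τ`
  have hxτ : ((x : GreenbergSelmer.decomp (K := K) v) : Field.absoluteGaloisGroup K) = resGalOfEmb ι τ := by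
    rw [← hτx]
    change _ = (resGal (K := K) (v.adicCompletion K)) τ
    rw [WeierstrassCurve.resGal_eq_absGaloisRestrict]
    rfl
  obtain ⟨k, hk⟩ := (AddCommGroup.mem_primaryComponent (p := p)).mp m.2
  set P := pointsMapOfEmb W ι (m : W.geomPoints) with hP
  have hp0 : ((p ^ k : ℕ) : ℤ) • (τ • P - P) = 0 := by
    have h1 : (p ^ k) • (resGalOfEmb ι τ • (m : W.geomPoints) - (m : W.geomPoints)) = 0 := by
      rw [smul_sub, smul_comm (p ^ k) (resGalOfEmb ι τ) (m : W.geomPoints), hk, smul_zero, sub_zero]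
    rw [hP, ← pointsMapOfEmb_smul, ← map_sub, natCast_zsmul, ← map_nsmul, h1, map_zero]
  have hfix := W.smul_localPoints_eq_of_mem_inertia_holds v (fun h ↦ h hv) (n := ((p ^ k : ℕ) : ℤ))
    (natCast_pow_notMem p hpv k) h𝔐 hτ' hp0
  rw [hP, ← pointsMapOfEmb_smul] at hfix
  have h1 := pointsMapOfEmb_injective W ι hfix
  apply Subtype.ext
  rw [primaryComponent.coe_smul, hxτ]
  exact h1

/-- **A residual class is unramified at a good `v ∤ p` as soon as its Kummer image is.** If the image of
`c ∈ H¹(H, E[p^∞][p])` in `H¹(H, E[p^∞])` restricts to zero on `H ⊓ I_v`, so does `c`: `H ⊓ I_v` acts trivially on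
`E[p^∞]` (`smul_eq_of_inertiaIn`), so a coboundary there is zero and the residual cocycle itself vanishes on `H ⊓ I_v`.
GV p. 28 (the residual groups of display (16) at `ℓ ∤ p`). [cite: GreenbergVatsal2000, §2 p. 28] -/
theorem mem_unramifiedKer_of_pushH1_mem_unramifiedKer {v : HeightOneSpectrum (𝓞 K)}
    (hv : W.HasGoodReductionAt v) (hpv : ((p : ℕ) : 𝓞 K) ∉ v.asIdeal)
    (c : subgroupH1 H ↥((↥(W.geomPrimaryTorsion p))[(p : ℤ)]))
    (hc : pushH1 H ((↥(W.geomPrimaryTorsion p))[(p : ℤ)]).subtype (subtype_torsionBy_smul W p) c ∈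
      GreenbergVatsal2000.unramifiedKer H ↥(W.geomPrimaryTorsion p) v) :
    c ∈ GreenbergVatsal2000.unramifiedKer H ↥((↥(W.geomPrimaryTorsion p))[(p : ℤ)]) v := by
  obtain ⟨φ, rfl⟩ := oneCocycleClass_surjective _ c
  have hk : pushH1 H ((↥(W.geomPrimaryTorsion p))[(p : ℤ)]).subtype (subtype_torsionBy_smul W p)
      (oneCocycleClass _ φ) = oneCocycleClass (discreteTopRep H (W.geomPrimaryTorsion p))
        (contOneCocycles.pullback (ContinuousMonoidHom.id H)
          (resHomOfEquivariant (ContinuousMonoidHom.id H) ((↥(W.geomPrimaryTorsion p))[(p : ℤ)]).subtype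
            (fun h x ↦ subtype_torsionBy_smul W p h x)) φ) :=
    map_oneCocycleClass _ _ _ φ
  rw [hk, GreenbergVatsal2000.unramifiedKer, AddMonoidHom.mem_ker] at hc
  erw [map_oneCocycleClass] at hc
  obtain ⟨m, hm⟩ := (oneCocycleClass_eq_zero_iff _ _).mp hc
  -- the values of `φ` on `H ⊓ I_v` vanish
  have hvan : ∀ x : ↥(GreenbergSelmer.inertiaIn H v), φ.1 (GreenbergSelmer.inertiaInToH H v x) = 0 := by
    intro x
    have h := hm x
    rw [contOneCocycles.pullback_apply, contOneCocycles.pullback_apply] at h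
    have htriv : (GreenbergSelmer.inertiaInToH H v x) • m - m = 0 := by
      rw [sub_eq_zero]
      exact smul_eq_of_inertiaIn W p H hv hpv x m
    have h' : ((φ.1 (GreenbergSelmer.inertiaInToH H v x) : ↥((↥(W.geomPrimaryTorsion p))[(p : ℤ)])) :
        ↥(W.geomPrimaryTorsion p)) = 0 := by
      refine Eq.trans ?_ (h.trans htriv)
      rfl
    exact Subtype.ext h'
  change oneCocycleClass _ φ ∈ (resH1Hom (GreenbergSelmer.inertiaInToH H v) (AddMonoidHom.id _) _).ker
  rw [AddMonoidHom.mem_ker]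
  erw [map_oneCocycleClass]
  refine (oneCocycleClass_eq_zero_iff _ _).mpr ⟨0, fun x ↦ ?_⟩
  rw [contOneCocycles.pullback_apply, map_zero, sub_zero, hvan x, map_zero]

end Curve

/-! ## §1b. `Sel^ε(E/K_∞) ≤ Sel♯_{S₀}` -/

section Tower

variable {K : Type u} [Field K] [NumberField K] (W : WeierstrassCurve K) [W.IsElliptic] {p : ℕ} [Fact p.Prime]
  (κ : ZpExtension K p)

/-- **`Sel^ε(E/K_∞)` lies in the imprimitive signed Selmer group `Sel♯_{S₀}(E/K_∞)`** for every set `S₀` containing the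
places of bad reduction: a class of `Sel^ε(E/K_∞)` is unramified at every good `v ∤ p` (classical condition there,
`mem_unramifiedKer_of_mem_localKerOver`) and satisfies the signed Kummer condition at `v ∣ p` w.r.t. `⨆ₙ E^ε(K_n·K_v)`
(`conjH1_mem_localKummerOverOfEmb_iSup_of_mem_signedSelmerInfty`). GV p. 20 ("Obviously, `S_A(ℚ_∞) ⊆ S^{Σ₀}_A(ℚ_∞)`"),
for Kobayashi's condition at `p`. [cite: GreenbergVatsal2000, §2 p. 20] [cite: Kobayashi2003, Def. 1.1] -/
theorem signedSelmerInfty_le_imprimitive (ε : ℤˣ) (S₀ : Set (HeightOneSpectrum (𝓞 K)))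
    (hS : ∀ v : HeightOneSpectrum (𝓞 K), ¬ W.HasGoodReductionAt v → v ∈ S₀) :
    signedSelmerInfty W κ ε ≤
      unramifiedOutside κ.kerSubgroup ↥(W.geomPrimaryTorsion p) p S₀ ⊓
        ⨅ (v : HeightOneSpectrum (𝓞 K)) (_ : ((p : ℕ) : 𝓞 K) ∈ v.asIdeal) (σ : Field.absoluteGaloisGroup K),
          (localKummerOverOfEmb W p κ.kerSubgroup (closureEmb (K := K) (v.adicCompletion K))
              (⨆ n : ℕ, signedLocalPoints κ (v.adicCompletion K) W ε n)).comap (W.conjH1 p κ.kerSubgroup σ) := by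
  intro s hs
  refine AddSubgroup.mem_inf.mpr ⟨?_, ?_⟩
  · rw [mem_unramifiedOutside_iff]
    intro v hvS hpv σ
    have hgood : W.HasGoodReductionAt v := by
      by_contra h; exact hvS (hS v h)
    have hSel := (W.mem_selmerGroupOver_iff p κ.kerSubgroup _).mp (signedSelmerInfty_le_selmerInfty W κ ε hs)
    exact mem_unramifiedKer_of_mem_localKerOver W p κ.kerSubgroup hgood hpv _ (hSel.1 v σ)
  · simp only [AddSubgroup.mem_iInf, AddSubgroup.mem_comap]
    intro v hv σ
    exact conjH1_mem_localKummerOverOfEmb_iSup_of_mem_signedSelmerInfty W κ ε hs v hv σ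

end Tower

end Summit.BirchSwinnertonDyer.BirchSwinnertonDyer.Theorems.SignedTransportAtTwo

end
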